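import Summits.QuantumFields.YangMills.Theorems.BalabanUVNodesN07ExistenceFromProp8

/-!
# BalabanUVNodes ∕ N07 ([Balaban1985Variational] Theorem 1 p. 279) — THE EXISTENCE SIDE AT PRINT's OWN RADIUS: Proposition 7, hence Theorem 1 over the
# whole family of record, from Prop. 7's UNIQUENESS sentence + Proposition 8 READ AS AN OBJECT SENTENCE at its radius `a₅` + Sect. F + boundary
# avoidance at the ONE fixed radius `ε₀ = a₅` (print's (6) in Prop. 8's regime «ε₀ ≤ a₅»)

Track A of `YM-PLAN.md` (cell `pub-ymgap`, HUMAN RULING D-0062), DAG node **N07**; seat `pub-ymgap-dag-n07-e` (generation 5; module 15, the fixed-radius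
companion of module 12 `…N07ExistenceFromProp8` (p489763); answers the referees' reader notes R-N07-11b-2 (ref-G g4) ∕ (R-P8) (ref-C g23): the displayed
sentences are now Proposition 8 VERBATIM AS AN OBJECT SENTENCE on critical configurations in the open space (6) at `ε₀ = a₅` (what a discharge of `p8`
must prove — module 9's `prop8Printed_famXOfRecord_fullyPinned_iff`) and boundary avoidance at that SAME single radius; `--supports stmt-QuantumFields-19903
--as helper`).  THEOREMS ONLY (0 `def`, 0 `sorry`); nothing imported is modified.

CONTENT (at the crit-pinned residual layer `ζ.pinCrit` of record; `B₃ ≥ 7`, `C₁ > 0`, `L³B₃a₁ ≤ a₅ < α₀`, `α₀` (53)-admissible):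
* `atMostOneCriticalOrbit_pinCrit_iff`, `prop8Printed_pinCrit_iff` (`Iff.rfl`) — the displayed (U7) and the typed Prop. 8 READ OBJECT SENTENCES at the pin;
* `prop8Printed_pinCrit_of_prop8At` — the tree's typed `B11.Prop8Printed ζ.B₃ (famXOfRecord F N ζ.pinCrit)` REBUILT from the object sentence at radius
  `a₅` (the (2)-class grows with its radius, so «for `ε₀ ≤ a₅`» follows from the sentence at `a₅`);
* ★★ `prop7Printed_pinCrit_of_atMostOne_prop8At_avoidanceAt` — `B11.Prop7Printed ζ.B₃ ζ.C₁ (famXOfRecord F N ζ.pinCrit)` from (U7) its uniqueness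
  sentence, (P8-a₅) Prop. 8's object sentence at `a₅`, (AV-a₅) boundary avoidance at `a₅` («every minimiser of (5) over `closure 𝔘_k(a₅) ∩ 𝔅_k(V)` lies
  in `𝔘_k(a₅)`», data with (7) at `ε₁ ≤ a₁`) — with `a′₁ := a₁` and `O₁ := 1∕C₁`, the existence sentence being THE MINIMAL ORBIT IN (8) ITSELF, delivered
  by module 12's fixed-radius induction `exists_isBackground_allLevels_of_prop8At_of_avoidanceAt` (direct method at radius `a₅` + Prop. 8);
* ★★★ `exists_thm1At_famV_pinCrit_of_atMostOne_prop8At_sectF_avoidanceAt`, `thm1Printed_Z11OfRecord_pinCrit_…`, `b11Leaf_Z11OfRecord_pinCrit_…` —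
  THEOREM 1 over the whole family of record ∕ `Thm1Printed` ∕ the [B11] LEAF from {(U7), (P8-a₅), Sect. F (+ Props 2–6, 9 for the leaf)} + (AV-a₅)
  (g2's closers p465289 BY NAME).

HONEST FRAMING.  Count-neutral bookkeeping; NOTHING of [Balaban1985Variational] asserted or proved — (U7), (P8-a₅), Sect. F are DISPLAYED printed statements
(object sentences at NODE 00's objects), (AV-a₅) is the displayed NON-printed soft sentence (the located existence-side residue of D-B11-2); N07 NOT
discharged (5∕27 unmoved); one finite four-torus programme at fixed `ε = L^{−K}` — NOT the continuum limit, NOT ℝ⁴, NOT infinite volume, NOT OS, NOT a mass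
gap, NOT Clay.  No `instance`, no notation, 0 kit.
-/

noncomputable section

namespace Summit.QuantumFields.YangMills.BalabanUVNodes.N07ExistenceFromProp8AtRadius

open Set Filter Topology
open Literature.MathematicalPhysics.QuantumFieldTheory.Balaban1983to89
open Literature.MathematicalPhysics.QuantumFieldTheory.Balaban1983to89.T4Continuum (T4Family)
open Literature.MathematicalPhysics.QuantumFieldTheory.Balaban1983to89.Node00
open Literature.MathematicalPhysics.QuantumFieldTheory.Balaban1983to89.ExpMeanLog (deltaSU)
open Literature.MathematicalPhysics.QuantumFieldTheory.Balaban1983to89.B12GaugeOrbits021 (OrbitRel)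
open Literature.MathematicalPhysics.QuantumFieldTheory.Balaban1983to89.B11Thm1 (Thm1At Exists8)
open Literature.MathematicalPhysics.QuantumFieldTheory.Balaban1983to89.B11Thm1CarrierTLevelZero (inUkClassB11_mono)
open Literature.MathematicalPhysics.QuantumFieldTheory.Balaban1983to89.DagBinding (B11Leaf)
open Summit.QuantumFields.YangMills.BalabanUVNodes.N07ExistenceFromProp8 (exists_isBackground_allLevels_of_prop8At_of_avoidanceAt)
open Summit.QuantumFields.YangMills.BalabanUVNodes.N07AtRecordCritPinned (exists_thm1At_famV_pinCrit_of_prop7_prop8_sectF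
  thm1Printed_Z11OfRecord_pinCrit_of_prop7_prop8_sectF b11Leaf_Z11OfRecord_pinCrit_of_parts)
open scoped Matrix.Norms.L2Operator

variable {F : T4Family} {N : ℕ} [NeZero N] (ζ : ResidZ F N)

omit [NeZero N] in
/-- Arithmetic of the radii: `B₃ ≥ 7`, `a₁ > 0`, `L³B₃a₁ ≤ a₅` ⇒ `0 < a₅`. [cite: Balaban1985Variational, (13) p.280 (bookkeeping)] -/
theorem radius_pos_of_le {B₃ a₁ a₅ : ℝ} (hB₃ : 7 ≤ B₃) (ha₁ : 0 < a₁) (ha₅ : (F.L : ℝ) ^ 3 * B₃ * a₁ ≤ a₅) : 0 < a₅ := by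
  have hL : (0 : ℝ) < (F.L : ℝ) := by exact_mod_cast (zero_lt_one.trans F.hL.2)
  have hB : (0 : ℝ) < B₃ := by linarith
  have : (0 : ℝ) < (F.L : ℝ) ^ 3 * B₃ * a₁ := by positivity
  linarith

/-- **WHAT THE DISPLAYED (U7) READS AT `ζ.pinCrit`** (`Iff.rfl`): Prop. 7's uniqueness sentence `AtMostOneCriticalOrbit ε₀ V` of the family of record is the
OBJECT sentence «any two critical configurations of (5) on `𝔅_k(V)` (curve-criticality `IsCritOfRecord`) lying in `𝔘_k(ε₀)` are related by a level-`k`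
residual gauge transformation (`OrbitRel k`, print's group (4))». [cite: Balaban1985Variational, Prop. 7 p.299, (4)–(6) p.278] -/
theorem atMostOneCriticalOrbit_pinCrit_iff (i : ZIdx) (ε₀ : ℝ) (V : GaugeField (F.P i.K) i.k (SU N)) :
    (famXOfRecord F N ζ.pinCrit i).AtMostOneCriticalOrbit ε₀ V ↔
      ∀ U U' : GaugeField (F.P i.K) 0 (SU N),
        InUkClassB11 F N i.K i.k ε₀ U → Averaging.iter (avOfRecord F N i.K) i.k U = V → IsCritOfRecord F N i.K i.k V U →
          InUkClassB11 F N i.K i.k ε₀ U' → Averaging.iter (avOfRecord F N i.K) i.k U' = V → IsCritOfRecord F N i.K i.k V U' →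
            OrbitRel i.k U U' :=
  Iff.rfl

/-- **WHAT THE TYPED PROPOSITION 8 READS AT `ζ.pinCrit`** (`Iff.rfl`; module 9's `prop8Printed_famXOfRecord_fullyPinned_iff` is the same reading at ζ⋆):
the hypothesis (P8-a₅) below is its body at the witness `a₅`. [cite: Balaban1985Variational, Prop. 8 p.304] -/
theorem prop8Printed_pinCrit_iff :
    B11.Prop8Printed ζ.B₃ (famXOfRecord F N ζ.pinCrit) ↔
      ∃ a₅ : ℝ, 0 < a₅ ∧ ∀ (i : ZIdx) (ε₀ ε₁ : ℝ), 0 < ε₁ → ∀ (V : GaugeField (F.P i.K) i.k (SU N)) (U : GaugeField (F.P i.K) 0 (SU N)),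
        PlaqSmall ε₁ V → InUkClassB11 F N i.K i.k ε₀ U → Averaging.iter (avOfRecord F N i.K) i.k U = V → IsCritOfRecord F N i.K i.k V U → ε₀ ≤ a₅ →
          InUkClassB11 F N i.K i.k (ζ.B₃ * ε₁) U :=
  Iff.rfl

/-- **THE TYPED PROPOSITION 8 REBUILT FROM ITS OBJECT SENTENCE AT RADIUS `a₅`**: if for every member, every `ε₁ > 0` and every `V` with (7), every critical
configuration of (5) on `𝔅_k(V)` lying in `𝔘_k(a₅)` lies in `𝔘_k(B₃ε₁)`, then `B11.Prop8Printed ζ.B₃ (famXOfRecord F N ζ.pinCrit)` — «for `ε₀ ≤ a₅`» by the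
growth of the (2)-class with its radius (n07-a's `inUkClassB11_mono`). [cite: Balaban1985Variational, Prop. 8 p.304] -/
theorem prop8Printed_pinCrit_of_prop8At {a₅ : ℝ} (ha₅ : 0 < a₅)
    (hP8 : ∀ (i : ZIdx) (ε₁ : ℝ), 0 < ε₁ → ∀ (V : GaugeField (F.P i.K) i.k (SU N)) (U : GaugeField (F.P i.K) 0 (SU N)), PlaqSmall ε₁ V →
      InUkClassB11 F N i.K i.k a₅ U → Averaging.iter (avOfRecord F N i.K) i.k U = V → IsCritOfRecord F N i.K i.k V U →
        InUkClassB11 F N i.K i.k (ζ.B₃ * ε₁) U) :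
    B11.Prop8Printed ζ.B₃ (famXOfRecord F N ζ.pinCrit) :=
  ⟨a₅, ha₅, fun i _ ε₁ hε₁ V U hV hU hUV hcrit hε₀ => hP8 i ε₁ hε₁ V U hV (inUkClassB11_mono hε₀ hU) hUV hcrit⟩

/-- ★★ **PROPOSITION 7 AT `ζ.pinCrit` FROM ITS UNIQUENESS SENTENCE, PROPOSITION 8's OBJECT SENTENCE AT `a₅`, AND BOUNDARY AVOIDANCE AT THE ONE RADIUS
`a₅`.**  DISPLAYED: (U7) «at most one critical orbit in (6)» per member (print's, Props 4–6); (P8-a₅) «critical configurations of (5) on `𝔅_k(V)` in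
`𝔘_k(a₅)` lie in `𝔘_k(B₃ε₁)`» per member, `ε₁ > 0`, `V` with (7) (print's Prop. 8 at its radius, Sect. F); (AV-a₅) «every minimiser of (5) over
`closure 𝔘_k(a₅) ∩ 𝔅_k(V)` lies in `𝔘_k(a₅)`» per member, `V` with (7) at `ε₁ ≤ a₁` (NOT printed); constants `B₃ ≥ 7`, `C₁ > 0`, `a₀, a₁ > 0`,
`L³B₃a₁ ≤ a₅ < α₀`, `α₀` (53)-admissible.  CONCLUSION: `B11.Prop7Printed ζ.B₃ ζ.C₁ (famXOfRecord F N ζ.pinCrit)` with `a′₁ := a₁`, `O₁ := 1∕C₁` — its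
existence sentence IS the minimal orbit in the space (8), from module 12's induction at the fixed radius `a₅` (level `0` the datum; inductive
background (11)–(13) from (8) one level down; THE DIRECT METHOD at radius `a₅`; (AV-a₅); (P8-a₅)). [cite: Balaban1985Variational, Prop. 7 p.299, Prop. 8 p.304, Thm 1 (8) p.279] -/
theorem prop7Printed_pinCrit_of_atMostOne_prop8At_avoidanceAt (hB₃ : 7 ≤ ζ.B₃) (hC₁ : 0 < ζ.C₁) {a₀ a₁ a₅ α₀ : ℝ} (ha₀ : 0 < a₀) (ha₁ : 0 < a₁)
    (ha₅ : (F.L : ℝ) ^ 3 * ζ.B₃ * a₁ ≤ a₅) (he : a₅ < α₀) (hα : 0 < α₀)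
    (hα3 : (143 * ((((4 + 4 : ℕ) : ℝ)) ^ 2 / 4) ^ 2) * α₀ ≤ 1 / 3)
    (hα2 : 2 * α₀ ≤ 2 * deltaSU (Fin N) / (((4 + 4) * F.L : ℕ) : ℝ) ^ 2)
    (huniq : ∀ (i : ZIdx) (ε₀ ε₁ : ℝ), 0 < ε₁ → ∀ V : GaugeField (F.P i.K) i.k (SU N), PlaqSmall ε₁ V → ε₀ ≤ a₀ → ζ.B₃ * ε₁ ≤ ε₀ →
      (famXOfRecord F N ζ.pinCrit i).AtMostOneCriticalOrbit ε₀ V)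
    (hP8 : ∀ (i : ZIdx) (ε₁ : ℝ), 0 < ε₁ → ∀ (V : GaugeField (F.P i.K) i.k (SU N)) (U : GaugeField (F.P i.K) 0 (SU N)), PlaqSmall ε₁ V →
      InUkClassB11 F N i.K i.k a₅ U → Averaging.iter (avOfRecord F N i.K) i.k U = V → IsCritOfRecord F N i.K i.k V U →
        InUkClassB11 F N i.K i.k (ζ.B₃ * ε₁) U)
    (hav : ∀ (i : ZIdx) (ε₁ : ℝ), 0 < ε₁ → ε₁ ≤ a₁ → ∀ V : GaugeField (F.P i.K) i.k (SU N), PlaqSmall ε₁ V →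
      ∀ U₀ : GaugeField (F.P i.K) 0 (SU N),
        IsBackground (avOfRecord F N i.K) (closure {U | InUkClassB11 F N i.K i.k a₅ U}) i.k V U₀ → InUkClassB11 F N i.K i.k a₅ U₀) :
    B11.Prop7Printed ζ.B₃ ζ.C₁ (famXOfRecord F N ζ.pinCrit) := by
  refine ⟨a₀, a₁, 1 / ζ.C₁, ha₀, ha₁, div_pos one_pos hC₁, fun i ε₀ ε₁ hε₁ V hV => ⟨huniq i ε₀ ε₁ hε₁ V hV, fun hε₁a => ?_⟩⟩
  have hrad : 1 / ζ.C₁ * ζ.C₁ * ζ.B₃ * ε₁ = ζ.B₃ * ε₁ := by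
    field_simp
  show ∃ U : GaugeField (F.P i.K) 0 (SU N),
    IsBackground (avOfRecord F N i.K) {U | InUkClassB11 F N i.K i.k (1 / ζ.C₁ * ζ.C₁ * ζ.B₃ * ε₁) U} i.k V U
  rw [hrad]
  have hα3K : (143 * (((((F.P i.K).d + 4 : ℕ) : ℝ)) ^ 2 / 4) ^ 2) * α₀ ≤ 1 / 3 := by
    rw [T4Family.P_d]; exact hα3
  have hα2K : 2 * α₀ ≤ 2 * deltaSU (Fin N) / ((((F.P i.K).d + 4) * (F.P i.K).L : ℕ) : ℝ) ^ 2 := by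
    rw [T4Family.P_d, T4Family.P_L]; exact hα2
  exact (exists_isBackground_allLevels_of_prop8At_of_avoidanceAt i.K hB₃ ha₁ ha₅ he hα hα3K hα2K
    (fun j _ hj ε₁ hε₁ _ V hV U hU hUV hcrit => hP8 ⟨i.K, j, hj⟩ ε₁ hε₁ V U hV hU hUV hcrit)
    (fun j _ hj ε₁ hε₁ hε₁a V hV U₀ hU₀ => hav ⟨i.K, j, hj⟩ ε₁ hε₁ hε₁a V hV U₀ hU₀) i.k i.hk ε₁ hε₁ hε₁a V hV).2

/-- ★★★ **THEOREM 1 AT ONE BLOCK OF CONSTANTS OVER THE WHOLE THEOREM-1 FAMILY OF RECORD** from (U7) + (P8-a₅) + Sect. F + (AV-a₅) — g2's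
`exists_thm1At_famV_pinCrit_of_prop7_prop8_sectF` (p465289) fed with the two rebuilt printed statements. [cite: Balaban1985Variational, Thm 1 p.279, Prop. 7 p.299, Prop. 8 p.304, Sect. F (169) p.305] -/
theorem exists_thm1At_famV_pinCrit_of_atMostOne_prop8At_sectF_avoidanceAt (hB₃ : 7 ≤ ζ.B₃) (hC₁ : 0 < ζ.C₁) {a₀ a₁ a₅ α₀ : ℝ}
    (ha₀ : 0 < a₀) (ha₁ : 0 < a₁) (ha₅ : (F.L : ℝ) ^ 3 * ζ.B₃ * a₁ ≤ a₅) (he : a₅ < α₀) (hα : 0 < α₀)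
    (hα3 : (143 * ((((4 + 4 : ℕ) : ℝ)) ^ 2 / 4) ^ 2) * α₀ ≤ 1 / 3)
    (hα2 : 2 * α₀ ≤ 2 * deltaSU (Fin N) / (((4 + 4) * F.L : ℕ) : ℝ) ^ 2)
    (huniq : ∀ (i : ZIdx) (ε₀ ε₁ : ℝ), 0 < ε₁ → ∀ V : GaugeField (F.P i.K) i.k (SU N), PlaqSmall ε₁ V → ε₀ ≤ a₀ → ζ.B₃ * ε₁ ≤ ε₀ →
      (famXOfRecord F N ζ.pinCrit i).AtMostOneCriticalOrbit ε₀ V)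
    (hP8 : ∀ (i : ZIdx) (ε₁ : ℝ), 0 < ε₁ → ∀ (V : GaugeField (F.P i.K) i.k (SU N)) (U : GaugeField (F.P i.K) 0 (SU N)), PlaqSmall ε₁ V →
      InUkClassB11 F N i.K i.k a₅ U → Averaging.iter (avOfRecord F N i.K) i.k U = V → IsCritOfRecord F N i.K i.k V U →
        InUkClassB11 F N i.K i.k (ζ.B₃ * ε₁) U)
    (sF : B11.SectFPrinted ζ.B₃ (famXOfRecord F N ζ.pinCrit))
    (hav : ∀ (i : ZIdx) (ε₁ : ℝ), 0 < ε₁ → ε₁ ≤ a₁ → ∀ V : GaugeField (F.P i.K) i.k (SU N), PlaqSmall ε₁ V →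
      ∀ U₀ : GaugeField (F.P i.K) 0 (SU N),
        IsBackground (avOfRecord F N i.K) (closure {U | InUkClassB11 F N i.K i.k a₅ U}) i.k V U₀ → InUkClassB11 F N i.K i.k a₅ U₀) :
    ∃ C : B11Thm1.Consts, C.B₃ = ζ.B₃ ∧ ∀ i : ZIdx, Thm1At C (famVOfRecord F N ζ i) :=
  have ha₅0 : 0 < a₅ := radius_pos_of_le (F := F) hB₃ ha₁ ha₅
  exists_thm1At_famV_pinCrit_of_prop7_prop8_sectF ζ (by linarith) hC₁
    (prop7Printed_pinCrit_of_atMostOne_prop8At_avoidanceAt ζ hB₃ hC₁ ha₀ ha₁ ha₅ he hα hα3 hα2 huniq hP8 hav)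
    (prop8Printed_pinCrit_of_prop8At ζ ha₅0 hP8) sF

/-- **`Thm1Printed` OVER THE [B11] BUNDLE OF RECORD** from the same display (g2's `thm1Printed_Z11OfRecord_pinCrit_of_prop7_prop8_sectF` BY NAME).
[cite: Balaban1985Variational, Thm 1 p.279, Prop. 7 p.299, Prop. 8 p.304, Sect. F (169) p.305] -/
theorem thm1Printed_Z11OfRecord_pinCrit_of_atMostOne_prop8At_sectF_avoidanceAt (hB₃ : 7 ≤ ζ.B₃) (hC₁ : 0 < ζ.C₁) {a₀ a₁ a₅ α₀ : ℝ}
    (ha₀ : 0 < a₀) (ha₁ : 0 < a₁) (ha₅ : (F.L : ℝ) ^ 3 * ζ.B₃ * a₁ ≤ a₅) (he : a₅ < α₀) (hα : 0 < α₀)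
    (hα3 : (143 * ((((4 + 4 : ℕ) : ℝ)) ^ 2 / 4) ^ 2) * α₀ ≤ 1 / 3)
    (hα2 : 2 * α₀ ≤ 2 * deltaSU (Fin N) / (((4 + 4) * F.L : ℕ) : ℝ) ^ 2)
    (huniq : ∀ (i : ZIdx) (ε₀ ε₁ : ℝ), 0 < ε₁ → ∀ V : GaugeField (F.P i.K) i.k (SU N), PlaqSmall ε₁ V → ε₀ ≤ a₀ → ζ.B₃ * ε₁ ≤ ε₀ →
      (famXOfRecord F N ζ.pinCrit i).AtMostOneCriticalOrbit ε₀ V)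
    (hP8 : ∀ (i : ZIdx) (ε₁ : ℝ), 0 < ε₁ → ∀ (V : GaugeField (F.P i.K) i.k (SU N)) (U : GaugeField (F.P i.K) 0 (SU N)), PlaqSmall ε₁ V →
      InUkClassB11 F N i.K i.k a₅ U → Averaging.iter (avOfRecord F N i.K) i.k U = V → IsCritOfRecord F N i.K i.k V U →
        InUkClassB11 F N i.K i.k (ζ.B₃ * ε₁) U)
    (sF : B11.SectFPrinted ζ.B₃ (famXOfRecord F N ζ.pinCrit))
    (hav : ∀ (i : ZIdx) (ε₁ : ℝ), 0 < ε₁ → ε₁ ≤ a₁ → ∀ V : GaugeField (F.P i.K) i.k (SU N), PlaqSmall ε₁ V →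
      ∀ U₀ : GaugeField (F.P i.K) 0 (SU N),
        IsBackground (avOfRecord F N i.K) (closure {U | InUkClassB11 F N i.K i.k a₅ U}) i.k V U₀ → InUkClassB11 F N i.K i.k a₅ U₀) :
    B11.Thm1Printed (Z11OfRecord F N ζ.pinCrit).famV :=
  have ha₅0 : 0 < a₅ := radius_pos_of_le (F := F) hB₃ ha₁ ha₅
  thm1Printed_Z11OfRecord_pinCrit_of_prop7_prop8_sectF ζ (by linarith) hC₁
    (prop7Printed_pinCrit_of_atMostOne_prop8At_avoidanceAt ζ hB₃ hC₁ ha₀ ha₁ ha₅ he hα hα3 hα2 huniq hP8 hav)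
    (prop8Printed_pinCrit_of_prop8At ζ ha₅0 hP8) sF

/-- **THE [B11] LEAF OF RECORD AT `ζ.pinCrit`** from Props 2–6, 9 + (U7) + (P8-a₅) + Sect. F + (AV-a₅) (g2's `b11Leaf_Z11OfRecord_pinCrit_of_parts` BY NAME; at
the presented layers p4, p6, p9 are theorems of record). [cite: Balaban1985Variational, Thm 1 p.279, Props 2–9 pp.281–309] -/
theorem b11Leaf_Z11OfRecord_pinCrit_of_parts_atMostOne_prop8At_avoidanceAt (hB₃ : 7 ≤ ζ.B₃) (hC₁ : 0 < ζ.C₁) {a₀ a₁ a₅ α₀ : ℝ}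
    (ha₀ : 0 < a₀) (ha₁ : 0 < a₁) (ha₅ : (F.L : ℝ) ^ 3 * ζ.B₃ * a₁ ≤ a₅) (he : a₅ < α₀) (hα : 0 < α₀)
    (hα3 : (143 * ((((4 + 4 : ℕ) : ℝ)) ^ 2 / 4) ^ 2) * α₀ ≤ 1 / 3)
    (hα2 : 2 * α₀ ≤ 2 * deltaSU (Fin N) / (((4 + 4) * F.L : ℕ) : ℝ) ^ 2)
    (p2 : B11.Prop2Printed ζ.B₁ ζ.B₃ ζ.C₁ ζ.c₁ ζ.famLG) (p3 : B11.Prop3Printed ζ.C₁ ζ.B₃ ζ.C₂ ζ.C₃ ζ.B₀ ζ.c1h ζ.c₄ ζ.δ₀ ζ.famLG)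
    (p4 : B11.Prop4Printed ζ.C₁ ζ.B₃ ζ.famLG) (p5 : B11.Prop5Printed ζ.B₁ ζ.B₃ ζ.C₁ ζ.famLG) (p6 : B11.Prop6Printed ζ.B₀ ζ.B₃ ζ.C₁ ζ.famLG)
    (huniq : ∀ (i : ZIdx) (ε₀ ε₁ : ℝ), 0 < ε₁ → ∀ V : GaugeField (F.P i.K) i.k (SU N), PlaqSmall ε₁ V → ε₀ ≤ a₀ → ζ.B₃ * ε₁ ≤ ε₀ →
      (famXOfRecord F N ζ.pinCrit i).AtMostOneCriticalOrbit ε₀ V)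
    (hP8 : ∀ (i : ZIdx) (ε₁ : ℝ), 0 < ε₁ → ∀ (V : GaugeField (F.P i.K) i.k (SU N)) (U : GaugeField (F.P i.K) 0 (SU N)), PlaqSmall ε₁ V →
      InUkClassB11 F N i.K i.k a₅ U → Averaging.iter (avOfRecord F N i.K) i.k U = V → IsCritOfRecord F N i.K i.k V U →
        InUkClassB11 F N i.K i.k (ζ.B₃ * ε₁) U)
    (sF : B11.SectFPrinted ζ.B₃ (famXOfRecord F N ζ.pinCrit)) (p9 : B11.Prop9Printed ζ.B₅ ζ.C₁ ζ.β₀ ζ.δ₀ ζ.famAn)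
    (hav : ∀ (i : ZIdx) (ε₁ : ℝ), 0 < ε₁ → ε₁ ≤ a₁ → ∀ V : GaugeField (F.P i.K) i.k (SU N), PlaqSmall ε₁ V →
      ∀ U₀ : GaugeField (F.P i.K) 0 (SU N),
        IsBackground (avOfRecord F N i.K) (closure {U | InUkClassB11 F N i.K i.k a₅ U}) i.k V U₀ → InUkClassB11 F N i.K i.k a₅ U₀) :
    B11Leaf (Z11OfRecord F N ζ.pinCrit) :=
  have ha₅0 : 0 < a₅ := radius_pos_of_le (F := F) hB₃ ha₁ ha₅
  b11Leaf_Z11OfRecord_pinCrit_of_parts ζ (by linarith) hC₁ p2 p3 p4 p5 p6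
    (prop7Printed_pinCrit_of_atMostOne_prop8At_avoidanceAt ζ hB₃ hC₁ ha₀ ha₁ ha₅ he hα hα3 hα2 huniq hP8 hav)
    (prop8Printed_pinCrit_of_prop8At ζ ha₅0 hP8) sF p9

end Summit.QuantumFields.YangMills.BalabanUVNodes.N07ExistenceFromProp8AtRadius

end
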